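import Literature.NumberTheory.Transcendental.AyoubPeriodSeriesDescent
import Mathlib.NumberTheory.NumberField.Basic

/-!
# The compact period conjecture: Ayoub's number-field form ⇔ the algebraic-image form

Proofs only; complement to `AyoubPeriodSeriesDescent.lean`. J. Ayoub, *Une version relative de la
conjecture des périodes de Kontsevich–Zagier*, Ann. of Math. 181 (2015), Conj. 1.1, states type-(a)
generation of `ker ∫_{[0,1]^∞}` on `𝒪_{k-alg}(𝔻̄^∞)` for `k` a NUMBER FIELD with a complex embedding;
J. Fresán, *Une introduction aux périodes* (X-UPS 2024), Conj. 3.5, states it for `k = ℚ`. Since `ℚ` is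
a number field and every number field has algebraic image in `ℂ`, the conjunction of Ayoub's printed
instances is EQUIVALENT to the single statement quantified over all fields of characteristic `0` with
algebraic image (`typeAGeneration_forall_iff_numberField`, via `typeAGeneration_forall_iff_rat`), which
is the rendering registered summit-side as the open conjecture `TypeAGenerationConjecture`
(`Summits/KontsevichZagierPeriods/KontsevichZagierPeriods/Theorems/TypeAGenerationConjecture.lean`).
Nothing is asserted about the conjecture itself.
-/

noncomputable section

namespace Literature.NumberTheory.Transcendental.AyoubRel

/-- A complex embedding of a number field has algebraic image. [folklore] -/
theorem isAlgebraic_apply_of_numberField {K : Type} [Field K] [NumberField K] (σ : K →+* ℂ) (c : K) :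
    IsAlgebraic ℚ (σ c) := by
  have hc : IsAlgebraic ℚ c := Algebra.IsAlgebraic.isAlgebraic c
  simpa using hc.algHom σ.toRatAlgHom

/-- **Ayoub's printed form ⇔ the algebraic-image form.** Type-(a) generation of the kernel of
`∫_{[0,1]^∞}` on `𝒪_{k-alg}(𝔻̄^∞)` for every field `k` of characteristic `0` with algebraic image in `ℂ`
is equivalent to the same statement for every NUMBER FIELD `k` (Ayoub 2015, Conj. 1.1, all instances):
`⇒` because number fields have algebraic image, `⇐` through the instance `k = ℚ` (Fresán's Conj. 3.5)
and `typeAGeneration_forall_iff_rat`. [cite: Ayoub2015, Conj. 1.1] -/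
theorem typeAGeneration_forall_iff_numberField :
    (∀ (k : Type) [Field k] [CharZero k] (σ : k →+* ℂ), (∀ c : k, IsAlgebraic ℚ (σ c)) →
      ∀ F ∈ Oan σ, intC F = 0 →
        F ∈ kSpan σ {x : CSeries | ∃ G ∈ Oan σ, ∃ i : ℕ, x = relAC i G}) ↔
    (∀ (K : Type) [Field K] [NumberField K] (σ : K →+* ℂ),
      ∀ F ∈ Oan σ, intC F = 0 →
        F ∈ kSpan σ {x : CSeries | ∃ G ∈ Oan σ, ∃ i : ℕ, x = relAC i G}) := by
  constructor
  · intro h K _ _ σ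
    exact h K σ (isAlgebraic_apply_of_numberField σ)
  · intro h
    exact typeAGeneration_forall_iff_rat.mpr (h ℚ (algebraMap ℚ ℂ))

end Literature.NumberTheory.Transcendental.AyoubRel
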